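import Summits.FinalStateConjecture.FinalStateConjecture.Theses.PhaseMixingCapture

/-!
# `AxisymmetricKappaWaveDecay` (support item `stmt-FinalStateConjecture-10751`, route
# `PhaseMixingCapture`): structural reductions

The support item is the axisymmetric (`Φψ = 0`) case of the crux `KappaExplicitWaveDecay`
(`stmt-FinalStateConjecture-10654`): κ-explicit uniform boundedness (clause (a)) and κ-explicit
integrated local energy decay (clause (b)) for smooth solutions of `□_g ψ = 0` on the sub-extremal
Kerr exterior with compactly supported data, with ONE pair `(p, j)` of exponent / derivative loss
serving both clauses. This file records, sorry-free, the logic that is independent of any estimate: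

* `axisymmetricKappaWaveDecay_of_kappaExplicitWaveDecay` — the crux implies the item (drop the
  axisymmetry hypothesis); the item therefore closes the moment the crux does.
* `kappaWeight_mono` — the weight `ENNReal.ofReal ((1 - (a/M)²)^(-p))` is monotone in `p` on the
  sub-extremal range (base in `(0, 1]`), and `initialEnergy_mono` — the order-`j` initial energy
  `E_j[ψ](0) = ∫ 𝟙_{slice} ∑_{m ≤ j} ‖D^m ψ̃(0, y)‖² dy` is monotone in `j`; hence both clauses are
  monotone in `(C, p, j)`.
* `axisymmetricKappaWaveDecay_of_clauses` — **splitting**: it suffices to prove clause (a) with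
  its own `(p₁, j₁)` and clause (b) with its own `(p₂, j₂)`; the item follows with
  `p = max p₁ p₂`, `j = max j₁ j₂`. (On paper the two clauses are different theorems — (a) is the
  Dafermos–Rodnianski red-shift boundedness argument for axisymmetric waves, arXiv:0811.0354 Thm. 7.1,
  with `κ`-tracked constants; (b) is a Morawetz estimate through trapping — and come with different
  losses: `j₁ = 1`, `j₂ = 2`.)
-/

-- the doubled `FinalStateConjecture.FinalStateConjecture` path component trips dupNamespace
set_option linter.dupNamespace false

noncomputable section

namespace Summit.FinalStateConjecture.FinalStateConjecture.Theorems.AxisymmetricKappaWaveDecay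

open Literature.Geometry.Lorentzian
open Summit.FinalStateConjecture.FinalStateConjecture.Theses.PhaseMixingCapture
open scoped Manifold ENNReal Topology ContDiff
open Filter Set MeasureTheory

/-! ### The crux implies the support item -/

/-- **The crux `KappaExplicitWaveDecay` implies its axisymmetric case** `AxisymmetricKappaWaveDecay`
(the extra hypothesis `∀ x, dψ_x(Φ) = 0` is simply dropped). [folklore] -/
theorem axisymmetricKappaWaveDecay_of_kappaExplicitWaveDecay (h : KappaExplicitWaveDecay) :
    AxisymmetricKappaWaveDecay := by
  intro _ _ M hM
  obtain ⟨p, j, ⟨C, hC, hA⟩, hB⟩ := h M hM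
  refine ⟨p, j, ⟨C, hC, fun a ha ψ hψ _ τ hτ ↦ hA a ha ψ hψ τ hτ⟩, fun R ↦ ?_⟩
  obtain ⟨C', hC', hB'⟩ := hB R
  exact ⟨C', hC', fun a ha ψ hψ _ ↦ hB' a ha ψ hψ⟩

/-! ### Monotonicity of the weight and of the initial energy -/

/-- **The κ-weight is monotone in the exponent**: for `|a| < M` and `p ≤ q`,
`(1 - (a/M)²)^(-p) ≤ (1 - (a/M)²)^(-q)` (the base lies in `(0, 1]` on the sub-extremal range — cf.
`NearExtremalKappaCapture.Negative.kappaSq_pos_le_one` — and a real power of such a base is antitone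
in the exponent). [folklore] -/
theorem kappaWeight_mono {M a p q : ℝ} (h : Kerr.IsSubextremal M a) (hpq : p ≤ q) :
    ENNReal.ofReal ((1 - (a / M) ^ 2) ^ (-p)) ≤ ENNReal.ofReal ((1 - (a / M) ^ 2) ^ (-q)) := by
  have hM : 0 < M := h.pos
  have ha : |a| < M := h
  have hq : (a / M) ^ 2 < 1 := by
    rw [div_pow, div_lt_one (by positivity)]
    exact sq_lt_sq' (abs_lt.1 ha).1 (abs_lt.1 ha).2
  exact ENNReal.ofReal_le_ofReal (Real.rpow_le_rpow_of_exponent_ge (by linarith)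
    (by nlinarith [sq_nonneg (a / M)]) (neg_le_neg hpq))

/-- **The order-`j` initial energy is monotone in `j`**: the integrand `∑_{m ≤ j} ‖D^m ψ̃‖²` only
gains nonnegative terms. [folklore] -/
theorem initialEnergy_mono {M a : ℝ} (ψ : Kerr.exterior M a → ℝ) {j j' : ℕ} (hjj' : j ≤ j') :
    (∫⁻ y : E3, {y | E4.ofTimeSpace 0 y ∈ Kerr.exterior M a}.indicator (fun y ↦ ENNReal.ofReal
      (∑ m ∈ Finset.range (j + 1), ‖iteratedFDeriv ℝ m (Function.extend Subtype.val ψ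
        (0 : E4 → ℝ)) (E4.ofTimeSpace 0 y)‖ ^ 2)) y) ≤
    ∫⁻ y : E3, {y | E4.ofTimeSpace 0 y ∈ Kerr.exterior M a}.indicator (fun y ↦ ENNReal.ofReal
      (∑ m ∈ Finset.range (j' + 1), ‖iteratedFDeriv ℝ m (Function.extend Subtype.val ψ
        (0 : E4 → ℝ)) (E4.ofTimeSpace 0 y)‖ ^ 2)) y := by
  refine lintegral_mono fun y ↦ Set.indicator_le_indicator (ENNReal.ofReal_le_ofReal ?_)
  exact Finset.sum_le_sum_of_subset_of_nonneg
    (Finset.range_mono (Nat.add_le_add_right hjj' 1)) fun _ _ _ ↦ sq_nonneg _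

/-! ### Splitting the item into its two clauses -/

/-- **Splitting.** `AxisymmetricKappaWaveDecay` follows from its two clauses proved SEPARATELY,
each with its own exponent and derivative loss: (a) κ-explicit uniform boundedness of the slice
energy of admissible axisymmetric waves with some `(p₁, j₁, C)`, and (b) κ-explicit integrated local
energy decay with some `(p₂, j₂)` and radius-dependent constants. The item's single pair is
`(max p₁ p₂, max j₁ j₂)` by `kappaWeight_mono` and `initialEnergy_mono`. [folklore] -/
theorem axisymmetricKappaWaveDecay_of_clauses
    (hA : ∀ [Kerr.Facts] [Kerr.SliceFacts], ∀ M : ℝ, 0 < M → ∃ (p : ℝ) (j : ℕ) (C : ℝ≥0∞), C < ⊤ ∧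
      ∀ a : ℝ, Kerr.IsSubextremal M a → ∀ ψ : Kerr.exterior M a → ℝ,
        (ContMDiff 𝓘(ℝ, E4) 𝓘(ℝ, ℝ) ∞ ψ ∧
          (∀ x, (Kerr.smoothMetric M a (Kerr.rPlus M a)).toPseudoRiemannianMetric.dalembertian ψ x
            = 0) ∧
          ∃ K : Set (Kerr.exterior M a), IsCompact K ∧ ∀ x : Kerr.exterior M a, (x : E4) 0 = 0 →
            x ∉ K → ψ x = 0 ∧ mfderiv 𝓘(ℝ, E4) 𝓘(ℝ, ℝ) ψ x = 0) →
        (∀ x : Kerr.exterior M a,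
          mfderiv 𝓘(ℝ, E4) 𝓘(ℝ, ℝ) ψ x (Kerr.axialField a (Kerr.rPlus M a) x) = 0) →
        ∀ τ : ℝ, 0 ≤ τ → sliceEnergy (Kerr.exterior M a) ψ τ ≤
          C * ENNReal.ofReal ((1 - (a / M) ^ 2) ^ (-p)) *
            ∫⁻ y : E3, {y | E4.ofTimeSpace 0 y ∈ Kerr.exterior M a}.indicator (fun y ↦
              ENNReal.ofReal (∑ m ∈ Finset.range (j + 1), ‖iteratedFDeriv ℝ m
                (Function.extend Subtype.val ψ (0 : E4 → ℝ)) (E4.ofTimeSpace 0 y)‖ ^ 2)) y)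
    (hB : ∀ [Kerr.Facts] [Kerr.SliceFacts], ∀ M : ℝ, 0 < M → ∃ (p : ℝ) (j : ℕ), ∀ R : ℝ,
      ∃ C : ℝ≥0∞, C < ⊤ ∧ ∀ a : ℝ, Kerr.IsSubextremal M a → ∀ ψ : Kerr.exterior M a → ℝ,
        (ContMDiff 𝓘(ℝ, E4) 𝓘(ℝ, ℝ) ∞ ψ ∧
          (∀ x, (Kerr.smoothMetric M a (Kerr.rPlus M a)).toPseudoRiemannianMetric.dalembertian ψ x
            = 0) ∧
          ∃ K : Set (Kerr.exterior M a), IsCompact K ∧ ∀ x : Kerr.exterior M a, (x : E4) 0 = 0 →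
            x ∉ K → ψ x = 0 ∧ mfderiv 𝓘(ℝ, E4) 𝓘(ℝ, ℝ) ψ x = 0) →
        (∀ x : Kerr.exterior M a,
          mfderiv 𝓘(ℝ, E4) 𝓘(ℝ, ℝ) ψ x (Kerr.axialField a (Kerr.rPlus M a) x) = 0) →
        ∫⁻ τ in Ioi (0 : ℝ), localSliceEnergy (Kerr.exterior M a) ψ τ R ≤
          C * ENNReal.ofReal ((1 - (a / M) ^ 2) ^ (-p)) *
            ∫⁻ y : E3, {y | E4.ofTimeSpace 0 y ∈ Kerr.exterior M a}.indicator (fun y ↦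
              ENNReal.ofReal (∑ m ∈ Finset.range (j + 1), ‖iteratedFDeriv ℝ m
                (Function.extend Subtype.val ψ (0 : E4 → ℝ)) (E4.ofTimeSpace 0 y)‖ ^ 2)) y) :
    AxisymmetricKappaWaveDecay := by
  intro _ _ M hM
  obtain ⟨p₁, j₁, C₁, hC₁, hA'⟩ := hA M hM
  obtain ⟨p₂, j₂, hB'⟩ := hB M hM
  refine ⟨max p₁ p₂, max j₁ j₂, ⟨C₁, hC₁, fun a ha ψ hψ hax τ hτ ↦ ?_⟩, fun R ↦ ?_⟩
  · exact (hA' a ha ψ hψ hax τ hτ).trans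
      (mul_le_mul' (mul_le_mul' le_rfl (kappaWeight_mono ha (le_max_left _ _)))
        (initialEnergy_mono ψ (le_max_left _ _)))
  · obtain ⟨C₂, hC₂, hB''⟩ := hB' R
    exact ⟨C₂, hC₂, fun a ha ψ hψ hax ↦ (hB'' a ha ψ hψ hax).trans
      (mul_le_mul' (mul_le_mul' le_rfl (kappaWeight_mono ha (le_max_right _ _)))
        (initialEnergy_mono ψ (le_max_right _ _)))⟩

end Summit.FinalStateConjecture.FinalStateConjecture.Theorems.AxisymmetricKappaWaveDecay

end
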